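import Summits.Ventures.YMGap.YM4Door.BlockTransport

/-!
# YM4Door / SpeciesTransport — the species dictionary (`liftObs`, `latticeConnectedCorr_eq_covariance`) and the uniform packaging for `SU(2)`,
# `d = 4`: `SU2.μW`, `SU2.AtTorusDoor`, `SU2.BlockingScheme`, `SU2.DoorRegime`, `SU2.GibbsFormAtDoorB`, T1 `SU2.FluctuationDecorrelationU`, T2
# `SU2.CondExpLocalityU`, `SU2.HandOverOnBlockTori` and the glue `SU2.handOverOnBlockTori_of_split` (PROVED)

HONEST FRAMING (cell `ym-beyond`, seat P2 «strong-coupling bridge», HUMAN RULING D-0035 / D-0037; g8 tree edition, 2026-08-25, split into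
≤ 400-line modules for the gate; memo `HOME/ROUTE-P2.md` v0.8, spec `HOME/ROUTE-P2-LIFT-SPEC.md` v2).  LATTICE / finite-torus bookkeeping only:
nothing here is a continuum, spectral or Clay-sense statement; nothing here moves the weak-coupling exit of Track A (uncertified); nothing
here is a part of Bałaban's theorems; NO effective action is asserted to be at any door.  NO conjecture name, NO `sorry`, NO axiom beyond
the standard three; label K = kernel bookkeeping.

Continuation of `YM4Door/BlockTransport.lean` (its header is the reference; §D and the `SU2` namespace of the one text).  T1 / T2 are
GAP-STATED requests to leg 1 (RG-native uniform statements), typed, not claimed; the glue is kernel bookkeeping over the exact covariance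
identity of `BlockTransport.lean`.  References: as there; memo `HOME/ROUTE-P2.md` §4b.
-/

set_option autoImplicit false

noncomputable section

open MeasureTheory ProbabilityTheory Finset Function
open Literature.Probability.LatticeModels Literature.Probability.LatticeModels.DobrushinMetric
open Literature.MathematicalPhysics.QuantumLattice hiding torusNorm configShift
open Literature.MathematicalPhysics.QuantumFieldTheory hiding ZdEdge
open Summit.Ventures.YMGap.RobustBall

namespace Summit.Ventures.YMGap.YM4Door

/-! ## §D  The species dictionary and the uniform packaging (SU(2), `d = 4`) -/

section Species

variable {N : ℕ} {G : Type} [Group G] [TopologicalSpace G] [IsTopologicalGroup G] [CompactSpace G]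
  [MeasurableSpace G] [BorelSpace G]

/-- The fine observable of a species `P` on the torus of side `L`: `U ↦ P(Ũ)` (periodic lift). -/
def liftObs (P : YMSpecies G) (L : ℕ) [NeZero L] : GaugeConfig 4 L G → ℝ :=
  fun U => P.F (Literature.MathematicalPhysics.QuantumLattice.torusLift L U)

/-- The fine observable of the time-translate by `n` of a species `Q`: `U ↦ Q(θ_{−n e₀} Ũ)`. -/
def liftObsShift (Q : YMSpecies G) (n : ℕ) (L : ℕ) [NeZero L] : GaugeConfig 4 L G → ℝ :=
  fun U => Q.F (Literature.MathematicalPhysics.QuantumLattice.configShift (-Pi.single 0 (n : ℤ))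
    (Literature.MathematicalPhysics.QuantumLattice.torusLift L U))

omit [TopologicalSpace G] [IsTopologicalGroup G] [CompactSpace G] [BorelSpace G] in
/-- The lifted species observable is measurable. -/
theorem measurable_liftObs (P : YMSpecies G) (L : ℕ) [NeZero L] : Measurable (liftObs P L) :=
  P.measurable.comp (measurable_torusLift L)

omit [TopologicalSpace G] [IsTopologicalGroup G] [CompactSpace G] [BorelSpace G] in
/-- The lifted, shifted species observable is measurable. -/
theorem measurable_liftObsShift (Q : YMSpecies G) (n L : ℕ) [NeZero L] : Measurable (liftObsShift Q n L) :=
  Q.measurable.comp ((Literature.MathematicalPhysics.QuantumLattice.configShift _).measurable.comp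
    (measurable_torusLift L))

/-- **Dictionary**: the ledger's connected time-correlation IS the covariance of the two fine observables under the
torus Wilson state (translation invariance of the state supplies `⟨Q ∘ θ⟩ = ⟨Q⟩`). -/
theorem latticeConnectedCorr_eq_covariance (ρ : G →* Matrix (Fin N) (Fin N) ℂ) (hρ : Continuous ρ) (β : ℝ)
    (L : ℕ) [NeZero L] (P Q : YMSpecies G) (n : ℕ) :
    latticeConnectedCorr ρ β L P.F Q.F n =
      cov[liftObs P L, liftObsShift Q n L; wilsonMeasure (d := 4) (L := L) ρ β] := by
  haveI := isProbabilityMeasure_wilsonMeasure (d := 4) (L := L) ρ hρ β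
  obtain ⟨MP, hMP⟩ := P.bounded
  obtain ⟨MQ, hMQ⟩ := Q.bounded
  have lP : MemLp (liftObs P L) 2 (wilsonMeasure (d := 4) (L := L) ρ β) :=
    memLp_two_of_abs_le (measurable_liftObs P L) fun U => hMP _
  have lQ : MemLp (liftObsShift Q n L) 2 (wilsonMeasure (d := 4) (L := L) ρ β) :=
    memLp_two_of_abs_le (measurable_liftObsShift Q n L) fun U => hMQ _
  rw [covariance_eq_sub lP lQ, latticeConnectedCorr]
  have hshift : ∫ U, liftObsShift Q n L U ∂wilsonMeasure (d := 4) (L := L) ρ β =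
      ∫ U, Q.F (Literature.MathematicalPhysics.QuantumLattice.torusLift L U) ∂wilsonMeasure (d := 4) (L := L) ρ β :=
    integral_comp_configShift_torusLift ρ β Q.F _
  simp only [Pi.mul_apply]
  rw [hshift]
  rfl

end Species

namespace SU2

open Literature.MathematicalPhysics.QuantumFieldTheory.Balaban1983to89.CrossoverLedger (RGFlowControl)

/-- The fine Wilson state of `SU(2)` at tree coupling `β` on the torus of side `L`. -/
abbrev μW (β : ℝ) (L : ℕ) [NeZero L] : Measure (GaugeConfig 4 L (SUN 2)) :=
  wilsonMeasure (d := 4) (L := L) ρ2 β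

/-- **At the torus door** (g0/g2 verbatim): effective coupling in `[0, 1/6]`, terms in the tier-2 ball
`InBall κ (11/500) (11/1000)`, `κ ≥ 1/100` — the hypotheses of the tree row `su2_torusClusteringOnBallW_star_oneThird_t100`. -/
@[folklore] def AtTorusDoor {S : ℕ} [NeZero S] (𝓔 : BalabanEffectiveAction 4 S (SUN 2) 1) (κ : ℝ) : Prop :=
  0 ≤ 𝓔.β ∧ 𝓔.β ≤ 1 / 6 ∧ 1 / 100 ≤ κ ∧ InBall κ (11 / 500) (11 / 1000) 𝓔.terms

/-- The door clusters (tree theorem, hypothesis-free): constant `16 e^{1/50}`, rate `1/100` in block units. -/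
theorem clustersWith_of_atTorusDoor {S : ℕ} [NeZero S] (hS : 3 ≤ S) (𝓔 : BalabanEffectiveAction 4 S (SUN 2) 1)
    {κ : ℝ} (h : AtTorusDoor 𝓔 κ) : ClustersWith 𝓔.terms 𝓔.β (16 * Real.exp (1 / 50)) (1 / 100) :=
  su2_torusClusteringOnBallW_star_oneThird_t100 κ h.2.2.1 𝓔.β h.1 h.2.1 S hS 𝓔.terms h.2.2.2

/-- **A blocking scheme**: ONE gauge block averaging for every block factor `b` and block-lattice side `S` (canonical
inhabitant: Bałaban's axial averaging `GaugeBlockAveraging.axial`).  H-b, T1 and T2 below are stated over the SAME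
scheme — the structure `GaugeBlockAveraging` only enforces gauge covariance and measurability, so quantifying T1/T2 over
ALL block averagings would be false (no locality); fixing the scheme is the honest typing. -/
def BlockingScheme : Type := ∀ (b S : ℕ) [NeZero S], GaugeBlockAveraging 4 (SUN 2) b S

/-- The axial scheme. -/
def BlockingScheme.axial : BlockingScheme := fun b S _ => GaugeBlockAveraging.axial b S

/-- **The door regime** of a flow device `F` at `β₀`: `(β, b)` such that `b = L^k` for a controlled step `k` of the
flow from bare `β` whose effective coupling is `≤ β₀`. -/
@[folklore] def DoorRegime (F : RGFlowControl) (β₀ : ℝ) (β : ℝ) (b : ℕ) : Prop :=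
  ∃ k : ℕ, b = F.L ^ k ∧ F.Controlled β k ∧ F.betaEff β k ≤ β₀

/-- **H-b over the scheme** (OPEN, node U-LF; g0's `GibbsFormAtDoor` with the block averaging taken from `𝔅`): in the
door regime, on every block torus `S ≥ 3`, the fine Wilson weight blocked through `𝔅 b S` has a Bałaban-format
effective density AT THE TORUS DOOR. -/
@[folklore] def GibbsFormAtDoorB (𝔅 : BlockingScheme) (Reg : ℝ → ℕ → Prop) (κ : ℝ) : Prop :=
  ∀ (β : ℝ) (b : ℕ) [NeZero b], Reg β b → ∀ (S : ℕ) [NeZero S], 3 ≤ S →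
    ∃ 𝓔 : BalabanEffectiveAction 4 S (SUN 2) 1, IsBalabanEffectiveActionOf ρ2 (𝔅 b S) β 𝓔 ∧ AtTorusDoor 𝓔 κ

/-- **T1 — FLUCTUATION DECORRELATION, uniform** (OPEN; the half of U-OBS that is about the fluctuation field): in the
regime, for every pair of species ONE constant `C₁` (species only) such that on every block-commensurate fine torus
`b·S` (`S ≥ 3`, `2n ≤ b S`) the fluctuation parts `P̃ − E[P̃ | V]`, `Q̃_n − E[Q̃_n | V]` of the species and its
time-translate have covariance `≤ C₁ e^{−(m₁/b) n}` — for ALL block versions (the covariance is version-independent).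
In print: the fluctuation (background-field-subtracted) fields at fixed block averages are massive with mass `O(1)` in
units of the LAST block scale (Bałaban CMP 99 (1985) propagator bounds (1.20)–(1.22); CMP 119 (1988) §2 localisation);
never stated as a covariance bound for conditional fluctuations of Wilson-loop observables — that is the gap. -/
@[folklore] def FluctuationDecorrelationU (𝔅 : BlockingScheme) (Reg : ℝ → ℕ → Prop) (m₁ : ℝ) : Prop :=
  0 < m₁ ∧ ∀ P Q : YMSpecies (SUN 2), ∃ C₁ : ℝ, ∀ (β : ℝ) (b : ℕ) [NeZero b] (S : ℕ) [NeZero S], Reg β b →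
    3 ≤ S → ∀ n : ℕ, 2 * n ≤ b * S → ∀ fA fB : GaugeConfig 4 S (SUN 2) → ℝ, Measurable fA → Measurable fB →
      (∃ M, ∀ V, |fA V| ≤ M) → (∃ M, ∀ V, |fB V| ≤ M) →
      IsBlockVersion (μW β (b * S)) (𝔅 b S).link (liftObs P (b * S)) fA →
      IsBlockVersion (μW β (b * S)) (𝔅 b S).link (liftObsShift Q n (b * S)) fB →
        |cov[fun U => liftObs P (b * S) U - fA ((𝔅 b S).link U),
            fun U => liftObsShift Q n (b * S) U - fB ((𝔅 b S).link U); μW β (b * S)]| ≤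
          C₁ * Real.exp (-(m₁ / b * n))

/-- **T2 — CONDITIONAL EXPECTATIONS ARE QUASI-LOCAL LIPSCHITZ CYLINDER OBSERVABLES OF THE BLOCK FIELD, uniform**
(OPEN; the other half of U-OBS): in the regime, for every pair of species, constants `(M, ℓ, C_ε, c₀)` (species only)
such that on every fine torus `b·S` (`S ≥ 3`, `2n ≤ bS`) the two observables have bounded measurable block versions
`f_A, f_B` which, for every range `R`, are within `C_ε e^{−κ' R}` in sup norm of measurable cylinder observables
`g_A, g_B` of the block field, bounded by `M`, with `suFrobDist`-Lipschitz sums `≤ ℓ`, supported on link sets whose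
mutual torus distance is `≥ n/b − c₀ − 2R` (the supports sit within `R` of the block sites of the two observables,
which are `≈ n/b` apart; the clause packages the torus-geometry bookkeeping `torusNorm_sub_le`, `torusNorm_proj_eq`).
EXACT finite support (`R`-independent) is FALSE — `E[P̃ | V]` depends on every block link through the massive
fluctuation field — hence the quasi-local typing.  In print: analyticity and localisation of the effective
observables / background field in the block variables (Bałaban CMP 116 (1988) Props. 1–3; CMP 119 (1988) (2.25)–(2.28)
for actions; Dimock's expository ultraviolet-stability series for observables in φ⁴₃/QED) — not isolated as a
statement about conditional expectations of gauge-invariant species; that is the gap. -/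
@[folklore] def CondExpLocalityU (𝔅 : BlockingScheme) (Reg : ℝ → ℕ → Prop) (κ' : ℝ) : Prop :=
  0 < κ' ∧ ∀ P Q : YMSpecies (SUN 2), ∃ (M ℓ Cε c₀ : ℝ), 0 ≤ M ∧ 0 ≤ ℓ ∧ 0 ≤ Cε ∧ 0 ≤ c₀ ∧
    ∀ (β : ℝ) (b : ℕ) [NeZero b] (S : ℕ) [NeZero S], Reg β b → 3 ≤ S → ∀ n : ℕ, 2 * n ≤ b * S →
      ∃ fA fB : GaugeConfig 4 S (SUN 2) → ℝ, Measurable fA ∧ Measurable fB ∧ (∀ V, |fA V| ≤ M) ∧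
        (∀ V, |fB V| ≤ M) ∧ IsBlockVersion (μW β (b * S)) (𝔅 b S).link (liftObs P (b * S)) fA ∧
        IsBlockVersion (μW β (b * S)) (𝔅 b S).link (liftObsShift Q n (b * S)) fB ∧
        ∀ R : ℕ, ∃ (gA gB : GaugeConfig 4 S (SUN 2) → ℝ) (ΔA ΔB : Finset (Edge 4 S)) (δA δB : Edge 4 S → ℝ),
          Measurable gA ∧ Measurable gB ∧ (∀ V, |gA V| ≤ M) ∧ (∀ V, |gB V| ≤ M) ∧
          DependsOn gA (↑ΔA : Set (Edge 4 S)) ∧ DependsOn gB (↑ΔB : Set (Edge 4 S)) ∧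
          IsLipBound suFrobDist gA δA ∧ IsLipBound suFrobDist gB δB ∧
          (∑ x ∈ ΔA, δA x) ≤ ℓ ∧ (∑ y ∈ ΔB, δB y) ≤ ℓ ∧
          (∀ V, |fA V - gA V| ≤ Cε * Real.exp (-(κ' * R))) ∧ (∀ V, |fB V - gB V| ≤ Cε * Real.exp (-(κ' * R))) ∧
          ∀ x ∈ ΔA, ∀ y ∈ ΔB, (n : ℝ) / b - c₀ - 2 * R ≤
            (Literature.MathematicalPhysics.QuantumFieldTheory.torusNorm (x.1 - y.1) : ℝ)

/-- **The conclusion currency: β-uniform hand-over ON THE BLOCK-COMMENSURATE TORI** — g2's `HandOverU` shape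
(one rate, species-only constants) but with the fine torus side restricted to `b·S`, `b = L^k`, `S ≥ 3`, and
`2n ≤ bS`.  The passage to ALL odd tori `2S'+1` (what `GapInUnits` / `HandOverU` literally want) is the volume
cofinality issue W5 of the memo — NOT claimed here. -/
@[folklore] def HandOverOnBlockTori (Reg : ℝ → ℕ → Prop) (m : ℝ) : Prop :=
  0 < m ∧ ∀ P Q : YMSpecies (SUN 2), ∃ C : ℝ, ∀ (β : ℝ) (b : ℕ) [NeZero b] (S : ℕ) [NeZero S], Reg β b →
    3 ≤ S → ∀ n : ℕ, 2 * n ≤ b * S →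
      |latticeConnectedCorr ρ2 β (b * S) P.F Q.F n| ≤ C * Real.exp (-(m / b * n))

/-- Exponent comparison: a faster rate is dominated by a slower one. -/
theorem exp_rate_mono {a a' : ℝ} (h : a' ≤ a) {b : ℕ} [NeZero b] (n : ℕ) :
    Real.exp (-(a / b * n)) ≤ Real.exp (-(a' / b * n)) := by
  have hb : (0 : ℝ) < b := by exact_mod_cast Nat.pos_of_ne_zero (NeZero.ne b)
  refine Real.exp_le_exp.2 (neg_le_neg ?_)
  exact mul_le_mul_of_nonneg_right (div_le_div_of_nonneg_right h hb.le) (Nat.cast_nonneg n)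

/-- **GLUE (proved): H-b over the scheme + T1 + T2 ⇒ the β-uniform hand-over on the block-commensurate tori**, at
rate `min m₁ (min (m/2) (κ'/4))` where `m = 1/100` is the door's rate — for SU(2) at the certified door
`(β₀, κ) = (1/6, ≥ 1/100)`, constants species-only.  The proof is `transport_inequality` with `R = ⌊n/(4b)⌋`. -/
theorem handOverOnBlockTori_of_split (𝔅 : BlockingScheme) (Reg : ℝ → ℕ → Prop) {κ m₁ κ' : ℝ}
    (hb : GibbsFormAtDoorB 𝔅 Reg κ) (hT1 : FluctuationDecorrelationU 𝔅 Reg m₁) (hT2 : CondExpLocalityU 𝔅 Reg κ') :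
    HandOverOnBlockTori Reg (min m₁ (min (1 / 200) (κ' / 4))) := by
  obtain ⟨hm₁, hT1⟩ := hT1
  obtain ⟨hκ', hT2⟩ := hT2
  refine ⟨lt_min hm₁ (lt_min (by norm_num) (by linarith)), fun P Q => ?_⟩
  obtain ⟨C₁, hC₁⟩ := hT1 P Q
  obtain ⟨M, ℓ, Cε, c₀, hM, hℓ, hCε, hc₀, hC₂⟩ := hT2 P Q
  set Acl : ℝ := 16 * Real.exp (1 / 50) with hAcl
  have hAcl0 : 0 ≤ Acl := by positivity
  -- the species-only constant
  refine ⟨max C₁ 0 + 4 * M * (Cε * Real.exp κ') + Acl * ℓ * ℓ * Real.exp (c₀ / 100), ?_⟩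
  intro β b _ S _ hreg hS n hn
  have hbpos : (0 : ℝ) < b := by exact_mod_cast Nat.pos_of_ne_zero (NeZero.ne b)
  -- H-b: the effective action at the door, and the door's clustering
  obtain ⟨𝓔, h𝓔, hdoor⟩ := hb β b hreg S hS
  have hcl := clustersWith_of_atTorusDoor hS 𝓔 hdoor
  -- T2: versions and approximants at range R = ⌊n/(4b)⌋
  obtain ⟨fA, fB, hfAm, hfBm, hfAb, hfBb, hvA, hvB, happ⟩ := hC₂ β b S hreg hS n hn
  set R : ℕ := ⌊(n : ℝ) / (4 * b)⌋₊ with hR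
  obtain ⟨gA, gB, ΔA, ΔB, δA, δB, hgAm, hgBm, hgAb, hgBb, hgAdep, hgBdep, hδA, hδB, hℓA, hℓB, hεA, hεB, hsep⟩ :=
    happ R
  -- T1 at these versions
  have h1 := hC₁ β b S hreg hS n hn fA fB hfAm hfBm ⟨M, hfAb⟩ ⟨M, hfBb⟩ hvA hvB
  -- integer separation fed to the door
  set s : ℝ := (n : ℝ) / b - c₀ - 2 * R with hs
  have hsepN : ∀ x ∈ ΔA, ∀ y ∈ ΔB,
      ⌈s⌉₊ ≤ Literature.MathematicalPhysics.QuantumFieldTheory.torusNorm (x.1 - y.1) :=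
    fun x hx y hy => Nat.ceil_le.2 (hsep x hx y hy)
  -- the transport inequality
  have key := transport_inequality h𝓔 hcl (measurable_liftObs P (b * S)) (measurable_liftObsShift Q n (b * S))
    hfAm hfBm hgAm hgBm (MA := Classical.choose P.bounded) (MB := Classical.choose Q.bounded)
    (fun U => Classical.choose_spec P.bounded _) (fun U => Classical.choose_spec Q.bounded _) hfAb hfBb hgAb hgBb
    hvA hvB h1 hεA hεB hgAdep hgBdep hδA hδB hsepN
  rw [latticeConnectedCorr_eq_covariance ρ2 (continuous_fundamentalRep (Fin 2)) β (b * S) P Q n]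
  refine key.trans ?_
  -- rate bookkeeping
  set mo : ℝ := min m₁ (min (1 / 200) (κ' / 4)) with hmo
  have E0 : 0 < Real.exp (-(mo / b * n)) := Real.exp_pos _
  -- (i) the T1 term
  have hC₁0 : C₁ ≤ max C₁ 0 := le_max_left _ _
  have i1 : C₁ * Real.exp (-(m₁ / b * n)) ≤ max C₁ 0 * Real.exp (-(mo / b * n)) := by
    have e1 : Real.exp (-(m₁ / b * n)) ≤ Real.exp (-(mo / b * n)) := exp_rate_mono (min_le_left _ _) n
    rcases le_or_gt 0 C₁ with hc | hc
    · rw [max_eq_left hc]; exact mul_le_mul_of_nonneg_left e1 hc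
    · have : C₁ * Real.exp (-(m₁ / b * n)) ≤ 0 := mul_nonpos_of_nonpos_of_nonneg hc.le (Real.exp_pos _).le
      have : 0 ≤ max C₁ 0 * Real.exp (-(mo / b * n)) := mul_nonneg (le_max_right _ _) E0.le
      linarith
  -- (ii) the truncation terms: e^{-κ' R} ≤ e^{κ'} e^{-(κ'/4)/b n}
  have hRlow : (n : ℝ) / (4 * b) - 1 ≤ R := by
    have := Nat.lt_floor_add_one ((n : ℝ) / (4 * b))
    rw [← hR] at this; linarith
  have i2e : Real.exp (-(κ' * R)) ≤ Real.exp κ' * Real.exp (-(mo / b * n)) := by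
    have e2 : Real.exp (-(κ' / 4 / b * n)) ≤ Real.exp (-(mo / b * n)) :=
      exp_rate_mono ((min_le_right _ _).trans (min_le_right _ _)) n
    have e3 : Real.exp (-(κ' * R)) ≤ Real.exp κ' * Real.exp (-(κ' / 4 / b * n)) := by
      rw [← Real.exp_add]
      refine Real.exp_le_exp.2 ?_
      have : κ' / 4 / b * n = κ' * ((n : ℝ) / (4 * b)) := by field_simp
      rw [this]; nlinarith
    exact e3.trans (mul_le_mul_of_nonneg_left e2 (Real.exp_pos _).le)
  have i2 : 2 * (Cε * Real.exp (-(κ' * R))) * M + 2 * M * (Cε * Real.exp (-(κ' * R))) ≤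
      4 * M * (Cε * Real.exp κ') * Real.exp (-(mo / b * n)) := by
    have := mul_le_mul_of_nonneg_left i2e (mul_nonneg hM hCε)
    nlinarith [this]
  -- (iii) the door term: e^{-(1/100)⌈s⌉} ≤ e^{c₀/100} e^{-(1/200)/b n}
  have hslow : (n : ℝ) / b - c₀ - (n : ℝ) / (2 * b) ≤ s := by
    have hRup : (R : ℝ) ≤ (n : ℝ) / (4 * b) := Nat.floor_le (by positivity)
    have : 2 * (R : ℝ) ≤ (n : ℝ) / (2 * b) := by
      have h4 : (n : ℝ) / (4 * b) * 2 = (n : ℝ) / (2 * b) := by field_simp; ring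
      linarith
    rw [hs]; linarith
  have i3e : Real.exp (-(1 / 100) * (⌈s⌉₊ : ℕ)) ≤ Real.exp (c₀ / 100) * Real.exp (-(mo / b * n)) := by
    have e2 : Real.exp (-(1 / 200 / b * n)) ≤ Real.exp (-(mo / b * n)) :=
      exp_rate_mono ((min_le_right _ _).trans (min_le_left _ _)) n
    have hceil : s ≤ (⌈s⌉₊ : ℕ) := Nat.le_ceil s
    have e3 : Real.exp (-(1 / 100) * (⌈s⌉₊ : ℕ)) ≤ Real.exp (c₀ / 100) * Real.exp (-(1 / 200 / b * n)) := by
      rw [← Real.exp_add]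
      refine Real.exp_le_exp.2 ?_
      have : (n : ℝ) / b - (n : ℝ) / (2 * b) = (n : ℝ) / (2 * b) := by field_simp; ring
      have h5 : 1 / 200 / (b : ℝ) * n = (1 / 100) * ((n : ℝ) / (2 * b)) := by field_simp; ring
      rw [h5]; nlinarith
    exact e3.trans (mul_le_mul_of_nonneg_left e2 (Real.exp_pos _).le)
  have i3 : Acl * (∑ y ∈ ΔB, δB y) * (∑ x ∈ ΔA, δA x) * Real.exp (-(1 / 100) * (⌈s⌉₊ : ℕ)) ≤
      Acl * ℓ * ℓ * Real.exp (c₀ / 100) * Real.exp (-(mo / b * n)) := by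
    have hA0 : 0 ≤ ∑ x ∈ ΔA, δA x := Finset.sum_nonneg fun x _ => hδA.nonneg x
    have hB0 : 0 ≤ ∑ y ∈ ΔB, δB y := Finset.sum_nonneg fun y _ => hδB.nonneg y
    have hprod : Acl * (∑ y ∈ ΔB, δB y) * (∑ x ∈ ΔA, δA x) ≤ Acl * ℓ * ℓ := by
      have := mul_le_mul hℓB hℓA hA0 hℓ
      calc Acl * (∑ y ∈ ΔB, δB y) * (∑ x ∈ ΔA, δA x) = Acl * ((∑ y ∈ ΔB, δB y) * (∑ x ∈ ΔA, δA x)) := by ring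
        _ ≤ Acl * (ℓ * ℓ) := mul_le_mul_of_nonneg_left this hAcl0
        _ = Acl * ℓ * ℓ := by ring
    calc Acl * (∑ y ∈ ΔB, δB y) * (∑ x ∈ ΔA, δA x) * Real.exp (-(1 / 100) * (⌈s⌉₊ : ℕ))
        ≤ Acl * ℓ * ℓ * Real.exp (-(1 / 100) * (⌈s⌉₊ : ℕ)) :=
          mul_le_mul_of_nonneg_right hprod (Real.exp_pos _).le
      _ ≤ Acl * ℓ * ℓ * (Real.exp (c₀ / 100) * Real.exp (-(mo / b * n))) :=
          mul_le_mul_of_nonneg_left i3e (by positivity)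
      _ = _ := by ring
  -- sum up
  have := add_le_add (add_le_add i1 i2) i3
  calc C₁ * Real.exp (-(m₁ / b * n)) +
        (2 * (Cε * Real.exp (-(κ' * R))) * M + 2 * M * (Cε * Real.exp (-(κ' * R)))) +
        Acl * (∑ y ∈ ΔB, δB y) * (∑ x ∈ ΔA, δA x) * Real.exp (-(1 / 100) * (⌈s⌉₊ : ℕ))
      ≤ max C₁ 0 * Real.exp (-(mo / b * n)) + 4 * M * (Cε * Real.exp κ') * Real.exp (-(mo / b * n)) +
          Acl * ℓ * ℓ * Real.exp (c₀ / 100) * Real.exp (-(mo / b * n)) := this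
    _ = (max C₁ 0 + 4 * M * (Cε * Real.exp κ') + Acl * ℓ * ℓ * Real.exp (c₀ / 100)) *
          Real.exp (-(mo / b * n)) := by ring

/-- With the door regime of a flow device `F` at `β₀ = 1/6` this is the hand-over the window target consumes, on the
block-commensurate tori. -/
theorem handOverOnBlockTori_doorRegime (F : RGFlowControl) (𝔅 : BlockingScheme) {κ m₁ κ' : ℝ}
    (hb : GibbsFormAtDoorB 𝔅 (DoorRegime F (1 / 6)) κ)
    (hT1 : FluctuationDecorrelationU 𝔅 (DoorRegime F (1 / 6)) m₁)
    (hT2 : CondExpLocalityU 𝔅 (DoorRegime F (1 / 6)) κ') :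
    HandOverOnBlockTori (DoorRegime F (1 / 6)) (min m₁ (min (1 / 200) (κ' / 4))) :=
  handOverOnBlockTori_of_split 𝔅 _ hb hT1 hT2

end SU2

end Summit.Ventures.YMGap.YM4Door

end
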